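import Summits.AtomisticToContinuum.HydrodynamicLimit.Theses.JParityClosure
import Literature.Analysis.FluidPDE.ConfinedHardSphereFlowShortBad

/-!
# The order-swapped `RateFloor` (`r₀` after `N`) is junk-true: the quantifier order carries the content

Negative knowledge for the crux `JParityClosure.RateFloor` (stmt-AtomisticToContinuum-13080), from the standing
disprover's `Cruxes/RateFloor/Disproof.lean` §4.  `RateFloorRAfterN` is the crux VERBATIM except that `∃ r₀` is moved
AFTER `∀ N ≥ N₀` (the mollification scale may shrink with `N`).  It is TRUE WITHOUT ANY DYNAMICS: with `r₀ := ε_N/2`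
the `r`-mollified pair functional `B^Ξ_r(z,s,x₀) = ∫ bx bx Θ^Ξ d(μ⊗μ)` vanishes identically along every good
trajectory — two distinct centres are `≥ ε_N` apart on the hard-sphere domain, so no two lie within `r` of the same
`x₀` (`bxProd_eq_zero_of_sep`, torus triangle inequality), and the diagonal atoms carry `Θ^Ξ(v,v) = 0`
(`hardSphereKernel (v,v) ω = 0`); hence the right-hand side is `−η < 0 ≤ K_N[χΞ]`, the deviation event lies in the
Liouville-null bad set of the flow, and the local Gibbs law is absolutely continuous (`particleLaw` is a
`withDensity` of the Liouville measure).  MORAL: the filed order `∃ r₀ ∀ r < r₀ ∃ N₀ ∀ N ≥ N₀` — `r` frozen while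
`ε_N = σ(N+1)^{-1/3} → 0`, so that `O((N r³)²)` pairs sit under each mollifier — is exactly what gives `RateFloor`
content, and any purported proof of the crux that never uses `ε_N < 2r` proves this vacuous variant instead.
refuter-cdisprove-stmt-AtomisticToContinuum-13080-0.
-/

noncomputable section

namespace Summit.AtomisticToContinuum.HydrodynamicLimit.Theorems

open MeasureTheory Filter Set Topology
open scoped ENNReal
open Literature.MathematicalPhysics.KineticTheory Literature.Analysis.FluidPDE

/-- The crux `RateFloor` with `∃ r₀` moved after `∀ N ≥ N₀` (all else verbatim). -/
def RateFloorRAfterN : Prop :=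
  ∃ g₀ : ℝ, 0 < g₀ ∧ ∀ (a₀ θ₀ : Literature.MathematicalPhysics.KineticTheory.T3 → ℝ) (u₀ : Literature.MathematicalPhysics.KineticTheory.T3 → Literature.MathematicalPhysics.KineticTheory.V3), Continuous a₀ → Continuous θ₀ → Continuous u₀ → (∀ x, 0 < a₀ x) → (∀ x, 0 < θ₀ x) → ∃ σ₀ : ℝ, 0 < σ₀ ∧ ∀ σ : ℝ, 0 < σ → σ < σ₀ → ∀ Φ : (N : ℕ) → Literature.Analysis.FluidPDE.HardSphereFlow (Literature.Analysis.FluidPDE.Torus.geometry (Fin 3)) (Literature.MathematicalPhysics.KineticTheory.hsDiameter σ N) (N + 1), ∀ τ : ℝ, 0 < τ → ∀ χ : ℝ × UnitAddTorus (Fin 3) → ℝ, Continuous χ → (∀ p, 0 ≤ χ p) → ∀ Ξ : EuclideanSpace ℝ (Fin 3) × EuclideanSpace ℝ (Fin 3) × EuclideanSpace ℝ (Fin 3) → ℝ, Continuous Ξ → (∀ q, 0 ≤ Ξ q) → (∃ C : ℝ, ∀ q, Ξ q ≤ C) → ∀ η δ : ℝ, 0 < η → 0 < δ → ∃ N₀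 : ℕ, ∀ N : ℕ, N₀ ≤ N → ∃ r₀ : ℝ, 0 < r₀ ∧ ∀ r : ℝ, 0 < r → r < r₀ → let ε := Literature.MathematicalPhysics.KineticTheory.hsDiameter σ N; let G := Literature.Analysis.FluidPDE.Torus.geometry (Fin 3); let γ := fun z (s : ℝ) => (Φ N).flow s z; let bx : UnitAddTorus (Fin 3) → UnitAddTorus (Fin 3) → ℝ := fun x y => 3 / (Real.pi * r ^ 3) * max (1 - Literature.Analysis.FluidPDE.Torus.euclidDist x y / r) 0; let Θ := fun (Ξ : EuclideanSpace ℝ (Fin 3) × EuclideanSpace ℝ (Fin 3) × EuclideanSpace ℝ (Fin 3) → ℝ) (v w : EuclideanSpace ℝ (Fin 3)) => ∫ ω : Metric.sphere (0 : EuclideanSpace ℝ (Fin 3)) 1, Ξ ((ω : EuclideanSpace ℝ (Fin 3)), v, w) * Literature.MathematicalPhysics.KineticTheory.hardSphereKernel (w, v) ω ∂Literature.MathematicalPhysics.KineticTheory.sphereMeasure; let B := fun Ξ z s (x₀ : UnitAddTorus (Fin 3)) => ∫ p, bx p.1.1 x₀ * bx p.2.1 x₀ * Θ Ξ p.1.2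 p.2.2 ∂((Literature.Analysis.FluidPDE.empiricalMeasure (γ z s)).prod (Literature.Analysis.FluidPDE.empiricalMeasure (γ z s))); let pv := fun z s (i j : Fin (N + 1)) => Literature.Analysis.FluidPDE.reflectVel (G.sepVec (γ z s i).1 (γ z s j).1) ((γ z s i).2, (γ z s j).2); let Kc := fun (Fn : Literature.Analysis.FluidPDE.Config (N + 1) (Fin 3) Literature.MathematicalPhysics.KineticTheory.T3 → ℝ → Fin (N + 1) → Fin (N + 1) → ℝ) z => ε / (N + 1 : ℝ) * ∑ᶠ (s : ℝ) (_ : s ∈ Literature.Analysis.FluidPDE.collisionTimes G ε (γ z) ∩ Set.Icc 0 τ), ∑ i : Fin (N + 1), ∑ j : Fin (N + 1), (if i ≠ j ∧ ‖G.sepVec (γ z s i).1 (γ z s j).1‖ = ε then Fn z s i j else 0); Literature.MathematicalPhysics.KineticTheory.localGibbsLaw σ a₀ u₀ θ₀ N (Φ N) {z | Kc (fun z s i j => χ (s, (γ z s i).1) * Ξ (ε⁻¹ • G.sepVec (γ z s i).1 (γ z s j).1, (pv z s i j).1, (pv z s i j).2)) z < g₀ * σ ^ 3 * (∫ s in Set.Icc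 (0 : ℝ) τ, ∫ x : UnitAddTorus (Fin 3), χ (s, x) * B Ξ z s x) - η} ≤ ENNReal.ofReal δ

namespace RateFloorRAfterN

/-- Hard-sphere exclusion beats the mollifier: if `2r < ε ≤ dist(x, y)` then `bx_r(x,x₀) · bx_r(y,x₀) = 0` for every
centre `x₀` (cone mollifier `bx_r(x,x₀) = 3/(πr³) · max(1 − dist(x,x₀)/r, 0)`, torus triangle inequality).
[folklore] -/
theorem bxProd_eq_zero_of_sep {ε r : ℝ} (hr : 0 < r) (h2r : 2 * r < ε) {x y : T3}
    (hxy : ε ≤ Torus.euclidDist x y) (x₀ : T3) :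
    (3 / (Real.pi * r ^ 3) * max (1 - Torus.euclidDist x x₀ / r) 0) *
      (3 / (Real.pi * r ^ 3) * max (1 - Torus.euclidDist y x₀ / r) 0) = 0 := by
  by_contra hne
  have hx : Torus.euclidDist x x₀ < r := by
    by_contra hx
    apply hne
    have : max (1 - Torus.euclidDist x x₀ / r) 0 = 0 :=
      max_eq_right (by rw [sub_nonpos, le_div_iff₀ hr, one_mul]; exact not_lt.mp hx)
    rw [this]; ring
  have hy : Torus.euclidDist y x₀ < r := by
    by_contra hy
    apply hne
    have : max (1 - Torus.euclidDist y x₀ / r) 0 = 0 :=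
      max_eq_right (by rw [sub_nonpos, le_div_iff₀ hr, one_mul]; exact not_lt.mp hy)
    rw [this]; ring
  have htri := Torus.euclidDist_triangle x x₀ y
  rw [Torus.euclidDist_comm x₀ y] at htri
  linarith

/-- Integration against the product of an empirical measure with itself only sees the atoms `(z i, z j)`: a
function vanishing on all of them integrates to `0` (`Measure.prod_prod_le`, the off-atom set is null for each
factor). [folklore] -/
theorem integral_prod_empiricalMeasure_eq_zero {N : ℕ} (z : Config (N + 1) (Fin 3) T3)
    (f : (T3 × V3) × (T3 × V3) → ℝ) (hf : ∀ i j, f (z i, z j) = 0) :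
    ∫ p, f p ∂((empiricalMeasure z).prod (empiricalMeasure z)) = 0 := by
  set μ := empiricalMeasure z with hμ
  set A : Set (T3 × V3) := Set.range z with hA
  have hAm : MeasurableSet A := (Set.finite_range z).measurableSet
  have hμA : μ Aᶜ = 0 := by
    rw [hμ, empiricalMeasure_eq, Measure.smul_apply, Measure.coe_finsetSum, Finset.sum_apply,
      Finset.sum_eq_zero, smul_zero]
    intro i _
    rw [Measure.dirac_apply' _ hAm.compl, Set.indicator_of_notMem]
    exact fun h => h ⟨i, rfl⟩
  have h1 : (μ.prod μ) (Aᶜ ×ˢ (univ : Set (T3 × V3))) = 0 :=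
    le_antisymm ((Measure.prod_prod_le _ _).trans (by rw [hμA, zero_mul])) zero_le
  have h2 : (μ.prod μ) ((univ : Set (T3 × V3)) ×ˢ Aᶜ) = 0 :=
    le_antisymm ((Measure.prod_prod_le _ _).trans (by rw [hμA, mul_zero])) zero_le
  refine integral_eq_zero_of_ae ?_
  rw [Filter.EventuallyEq, ae_iff]
  refine measure_mono_null (fun p hp => ?_) (measure_union_null h1 h2)
  simp only [Set.mem_setOf_eq, Pi.zero_apply] at hp
  by_contra hne
  simp only [Set.mem_union, Set.mem_prod, Set.mem_univ, and_true, true_and, Set.mem_compl_iff, not_or,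
    not_not, hA, Set.mem_range] at hne
  obtain ⟨⟨i, hi⟩, ⟨j, hj⟩⟩ := hne
  apply hp
  have : p = (z i, z j) := Prod.ext hi.symm hj.symm
  rw [this]
  exact hf i j

/-- The order-swapped `RateFloor` holds for the wrong reason (no dynamics): `r₀ := ε_N/2` kills the pair functional on
every good trajectory, the right-hand side is `−η < 0 ≤ K_N`, and the bad set of the flow is null for the
(absolutely continuous) local Gibbs law. [folklore] -/
theorem rateFloorRAfterN_holds : RateFloorRAfterN := by
  refine ⟨1, one_pos, ?_⟩
  intro a₀ θ₀ u₀ _ _ _ _ _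
  refine ⟨4⁻¹, by norm_num, ?_⟩
  intro σ hσ _ Φ τ _ χ _ hχ0 Ξ _ hΞ0 _ η δ hη _
  refine ⟨0, fun N _ => ⟨hsDiameter σ N / 2, half_pos (hsDiameter_pos hσ N), ?_⟩⟩
  intro r hr hrlt ε G γ bx Θ B pv Kc
  have hε : 0 < ε := hsDiameter_pos hσ N
  have h2r : 2 * r < ε := by show 2 * r < hsDiameter σ N; linarith
  have hgood : localGibbsLaw σ a₀ u₀ θ₀ N (Φ N) (Φ N).goodᶜ = 0 := by
    rw [localGibbsLaw, particleLaw_eq]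
    exact withDensity_absolutelyContinuous _ _ (Φ N).measure_compl_good
  refine (measure_mono ?_).trans (hgood.le.trans zero_le)
  intro z hz hzg
  simp only [Set.mem_setOf_eq] at hz
  have hB : ∀ s x₀, B Ξ z s x₀ = 0 := by
    intro s x₀
    show ∫ p, bx p.1.1 x₀ * bx p.2.1 x₀ * Θ Ξ p.1.2 p.2.2
      ∂((empiricalMeasure (γ z s)).prod (empiricalMeasure (γ z s))) = 0
    apply integral_prod_empiricalMeasure_eq_zero
    intro i j
    by_cases hij : i = j
    · subst hij
      have hΘ : Θ Ξ (γ z s i).2 (γ z s i).2 = 0 := by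
        show ∫ ω, Ξ ((ω : V3), (γ z s i).2, (γ z s i).2) *
          hardSphereKernel ((γ z s i).2, (γ z s i).2) ω ∂sphereMeasure = 0
        simp [hardSphereKernel]
      show bx (γ z s i).1 x₀ * bx (γ z s i).1 x₀ * Θ Ξ (γ z s i).2 (γ z s i).2 = 0
      rw [hΘ, mul_zero]
    · have hmem : γ z s ∈ hardSphereDomain G (N + 1) ε := ((Φ N).isTrajectory z hzg).mem s
      have hsep : ε ≤ Torus.euclidDist (γ z s i).1 (γ z s j).1 := hmem i j hij
      have h0 := bxProd_eq_zero_of_sep hr h2r hsep x₀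
      show bx (γ z s i).1 x₀ * bx (γ z s j).1 x₀ * Θ Ξ (γ z s i).2 (γ z s j).2 = 0
      rw [show bx (γ z s i).1 x₀ * bx (γ z s j).1 x₀ = 0 from h0, zero_mul]
  have hI : (∫ s in Set.Icc (0 : ℝ) τ, ∫ x : UnitAddTorus (Fin 3), χ (s, x) * B Ξ z s x) = 0 := by
    simp [hB]
  have hK : 0 ≤ Kc (fun z s i j => χ (s, (γ z s i).1) *
      Ξ (ε⁻¹ • G.sepVec (γ z s i).1 (γ z s j).1, (pv z s i j).1, (pv z s i j).2)) z := by
    refine mul_nonneg (div_nonneg hε.le (by positivity)) (finsum_nonneg fun s => finsum_nonneg fun _ =>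
      Finset.sum_nonneg fun i _ => Finset.sum_nonneg fun j _ => ?_)
    split_ifs
    · exact mul_nonneg (hχ0 _) (hΞ0 _)
    · exact le_rfl
  rw [hI, mul_zero, zero_sub] at hz
  linarith

end RateFloorRAfterN

end Summit.AtomisticToContinuum.HydrodynamicLimit.Theorems
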